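import Mathlib
import HarnessLib
import Summits.ResolutionOfSingularities.ResolutionOfSingularities.Theorems.WildQuotientsWildQuotientResolutionS1aOneShotKill

/-!
# S1a — (T2a v3) the abstract one-shot kill lemma in BOUNDARY FORM with GENERAL SHIFT `δ`

[OURS · L1 W4.5c · lead-1 g6, after plan-1 g11's SIG v3 `L/w45c/W45cT2Signatures.lean` c87cfa39393726bf «GENERAL WEIGHTS» and
memo `L/w45c/T2-THEOREM-SHEET.md` §8/§10] — NOT a statement of the manuscript; counted 0; AI-level work, weaker than expert
review. Crux stmt-ResolutionOfSingularities-17941, line `s1a-logminvertex` v6, stub `stub_winningStrategy` ((R0) branch).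

**`augmentationIdeal_eq_span_of_oneShot_shift`** (= sheet v3 `AbstractOneShotKill`; `abstractOneShotKill_shift` is the
∀-form): `B → C` with compatible `σ`, `τ`; `ε` (old boundary monomial), `e` (exceptional parameter), shift `0 < δ`; IF the
`g i` generate `C`, `δ ≤ w i` and `ε g i e^{w i}` lies in the extension of `I_σ`, gr-shift `τ x − x ∈ (ε e^δ)`, and every `i`
is BOTTOM (`w i = δ`) or HIT (`τ (g h) − g h − ε u g i^k e^δ ∈ (ε e^{δ+1})`, `u` a unit mod `e`, `0 < k`), THEN
`augmentationIdeal τ = (ε e^δ)` — principal, i.e. a Király–Lütkebohmert KILL with new boundary `ε e`. The depth case is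
`ε = 1, δ = 1, k = 1` (`…S1aOneShotKill`). Same conductor argument: `J = (I_τ : ε e^δ)` is the unit ideal.
-/

set_option linter.dupNamespace false

noncomputable section

open Literature.AlgebraicGeometry.Resolution

namespace Summit.ResolutionOfSingularities.ResolutionOfSingularities.Theorems.WildQuotientResolution.S1.OneShotKill

universe u

variable {B C : Type u} [CommRing B] [CommRing C] [Algebra B C]

/-- **(T2a v3) ABSTRACT ONE-SHOT KILL, boundary form, general shift.** [OURS · L1 W4.5c] -/
theorem augmentationIdeal_eq_span_of_oneShot_shift (σ : B ≃+* B) (τ : C ≃+* C)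
    (hcompat : ∀ b : B, τ (algebraMap B C b) = algebraMap B C (σ b))
    {ι : Type*} (g : ι → C) (w : ι → ℕ) (δ : ℕ) (ε e : C)
    (hcov : Ideal.span (Set.range g) = ⊤)
    (hcentre : ∀ i, δ ≤ w i ∧ ε * g i * e ^ (w i) ∈ (augmentationIdeal σ).map (algebraMap B C))
    (hgr : ∀ x : C, τ x - x ∈ Ideal.span {ε * e ^ δ})
    (hrel : ∀ i, w i = δ ∨ ∃ (h : ι) (u : C) (k : ℕ), 0 < k ∧ IsUnit (Ideal.Quotient.mk (Ideal.span {e}) u) ∧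
        τ (g h) - g h - ε * u * g i ^ k * e ^ δ ∈ Ideal.span {ε * e ^ (δ + 1)}) :
    augmentationIdeal τ = Ideal.span {ε * e ^ δ} := by
  classical
  refine le_antisymm (augmentationIdeal_le_span τ _ hgr) ?_
  rw [Ideal.span_singleton_le_iff_mem]
  -- the conductor `J = (I_τ : ε e^δ)`
  let J : Ideal C := (augmentationIdeal τ).colon {ε * e ^ δ}
  have hJ : ∀ c : C, c ∈ J ↔ c * (ε * e ^ δ) ∈ augmentationIdeal τ := fun c => by
    rw [Submodule.mem_colon_singleton, smul_eq_mul]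
  by_contra he
  have hJtop : J ≠ ⊤ := by
    intro h
    have h1 : (1 : C) ∈ J := by rw [h]; trivial
    rw [hJ, one_mul] at h1
    exact he h1
  obtain ⟨𝔪, h𝔪, hJ𝔪⟩ := Ideal.exists_le_maximal J hJtop
  have hgi : ∃ i, g i ∉ 𝔪 := by
    by_contra hall
    push Not at hall
    have : Ideal.span (Set.range g) ≤ 𝔪 := by
      rw [Ideal.span_le]; rintro _ ⟨i, rfl⟩; exact hall i
    rw [hcov, top_le_iff] at this
    exact h𝔪.ne_top this
  obtain ⟨i, hi⟩ := hgi
  have hgie : ε * g i * e ^ (w i) ∈ augmentationIdeal τ := map_augmentationIdeal_le σ τ hcompat (hcentre i).2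
  by_cases hem : e ∈ 𝔪
  swap
  · -- `e ∉ 𝔪`: `g i e^{w i - δ} ∈ J ⊆ 𝔪`
    have hmem : g i * e ^ (w i - δ) ∈ J := by
      rw [hJ]
      have hpow : e ^ w i = e ^ (w i - δ) * e ^ δ := by rw [← pow_add, Nat.sub_add_cancel (hcentre i).1]
      have : g i * e ^ (w i - δ) * (ε * e ^ δ) = ε * g i * e ^ (w i) := by rw [hpow]; ring
      rw [this]; exact hgie
    rcases h𝔪.isPrime.mem_or_mem (hJ𝔪 hmem) with h1 | h2
    · exact hi h1
    · exact hem (h𝔪.isPrime.mem_of_pow_mem _ h2)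
  rcases hrel i with hbot | ⟨h, u, k, hk, hu, hhit⟩
  · -- bottom: `ε g i e^δ ∈ I_τ`, so `g i ∈ J ⊆ 𝔪`
    have hmem : g i ∈ J := by
      rw [hJ]
      have : g i * (ε * e ^ δ) = ε * g i * e ^ (w i) := by rw [hbot]; ring
      rw [this]; exact hgie
    exact hi (hJ𝔪 hmem)
  · -- hit: `τ (g h) - g h = ε e^δ (u g i^k + x e)`
    obtain ⟨x, hx⟩ := Ideal.mem_span_singleton'.mp hhit
    have hmem : u * g i ^ k + x * e ∈ J := by
      rw [hJ]
      have : (u * g i ^ k + x * e) * (ε * e ^ δ) = τ (g h) - g h := by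
        have e1 : x * (ε * e ^ (δ + 1)) = τ (g h) - g h - ε * u * g i ^ k * e ^ δ := hx
        rw [pow_succ] at e1
        linear_combination e1
      rw [this]
      exact sub_mem_augmentationIdeal τ _
    have h1 : u * g i ^ k + x * e ∈ 𝔪 := hJ𝔪 hmem
    have h2 : u * g i ^ k ∈ 𝔪 := by
      have := 𝔪.sub_mem h1 (𝔪.mul_mem_left x hem)
      rwa [add_sub_cancel_right] at this
    have hu𝔪 : u ∈ 𝔪 := by
      rcases h𝔪.isPrime.mem_or_mem h2 with h3 | h3
      · exact h3
      · exact absurd (h𝔪.isPrime.mem_of_pow_mem _ h3) hi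
    obtain ⟨v', hv'⟩ := hu.exists_right_inv
    obtain ⟨v, rfl⟩ := Ideal.Quotient.mk_surjective v'
    rw [← map_mul, ← map_one (Ideal.Quotient.mk (Ideal.span {e})), Ideal.Quotient.eq] at hv'
    have h3 : u * v - 1 ∈ 𝔪 := (Ideal.span_singleton_le_iff_mem 𝔪).mpr hem hv'
    have h4 : (1 : C) ∈ 𝔪 := by
      have := 𝔪.sub_mem (𝔪.mul_mem_right v hu𝔪) h3
      rwa [sub_sub_cancel] at this
    exact h𝔪.ne_top ((Ideal.eq_top_iff_one 𝔪).mpr h4)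

/-- (T2a v3) in the ∀-form of plan-1's signature sheet v3 (`OneShotKillSig.AbstractOneShotKill`, c87cfa39393726bf). -/
theorem abstractOneShotKill_shift (B C : Type u) [CommRing B] [CommRing C] [Algebra B C] (σ : B ≃+* B) (τ : C ≃+* C)
    (hcompat : ∀ b : B, τ (algebraMap B C b) = algebraMap B C (σ b))
    (ι : Type) [Finite ι] (g : ι → C) (w : ι → ℕ) (δ : ℕ) (ε e : C) (_hδ : 0 < δ)
    (hcov : Ideal.span (Set.range g) = ⊤)
    (hcentre : ∀ i, δ ≤ w i ∧ ε * g i * e ^ (w i) ∈ (augmentationIdeal σ).map (algebraMap B C))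
    (hgr : ∀ x : C, τ x - x ∈ Ideal.span {ε * e ^ δ})
    (hrel : ∀ i, w i = δ ∨ ∃ (h : ι) (u : C) (k : ℕ), 0 < k ∧ IsUnit (Ideal.Quotient.mk (Ideal.span {e}) u) ∧
        τ (g h) - g h - ε * u * g i ^ k * e ^ δ ∈ Ideal.span {ε * e ^ (δ + 1)}) :
    augmentationIdeal τ = Ideal.span {ε * e ^ δ} :=
  augmentationIdeal_eq_span_of_oneShot_shift σ τ hcompat g w δ ε e hcov hcentre hgr hrel

end Summit.ResolutionOfSingularities.ResolutionOfSingularities.Theorems.WildQuotientResolution.S1.OneShotKill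

end
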